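import Mathlib.FieldTheory.AlgebraicClosure
import Literature.NumberTheory.Transcendental.KZSemialgebraicComplex
import HarnessLib

/-!
# One-variable integral representations of Kontsevich–Zagier periods, and algebraic constants

Auxiliary results (all proved) for discharging period statements of
`Literature/NumberTheory/Transcendental/KontsevichZagier.lean` whose natural proof is a
one-dimensional integral `∫₀¹ h(s) ds` of an explicit real-algebraic function `h` (e.g. the
elliptic integrals of Kontsevich–Zagier 2001, §1.1). Tools:

* **atoms** (`isSemialgebraicFunOn_apply`, `isSemialgebraicFunOn_ratCast`): coordinate
  functions and rational constants are `ℚ`-semialgebraic functions (real algebraic constants,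
  quotients and complex square roots are in `KZSemialgebraicComplex.lean`);
* **algebraic constants** (`isAlgebraic_of_cubic_eq_zero`, `isAlgebraic_of_sq_eq`): roots of the
  Weierstrass cubic `4x³ - g₂x - g₃` with algebraic `g₂, g₃`, and square roots of algebraic
  numbers, are algebraic over `ℚ` (so their real and imaginary parts may serve as coefficients);
* **interval integrals are periods** (`isRealPeriod_intervalIntegral`,
  `isPeriod_intervalIntegral`): if `s ↦ h(s)` is `ℚ`-semialgebraic on `(0, 1)` (as a function on
  `ℝ¹`) and integrable there, then `∫₀¹ h` is a real period; for complex `h` with semialgebraic real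
  and imaginary parts, `∫₀¹ h` is a period. This is the bridge
  `KZ.isRealPeriod_iff_exists_integralRep_holds` (algebraic integrands give the same periods,
  Kontsevich–Zagier §1.1) specialised to the unit interval.

No new definitions; namespace `Literature.NumberTheory.Transcendental` (path namespace).

## References

* M. Kontsevich, D. Zagier, *Periods* (2001), §1.1.
* J. Bochnak, M. Coste, M.-F. Roy, *Real Algebraic Geometry* (1998), §2.2, Prop. 2.2.6.
-/

noncomputable section

open Set MvPolynomial MeasureTheory
open Literature.ModelTheory.ExponentialFields (IsSemialgebraic)

namespace Literature.NumberTheory.Transcendental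

variable {m : ℕ}

/-! ### Atoms: coordinates and rational constants -/

/-- Coordinate functions are `k`-semialgebraic on every `k`-semialgebraic set (they are
polynomials). [cite: BochnakCosteRoy1998, §2.2] -/
theorem isSemialgebraicFunOn_apply {k : Type*} [CommRing k] [Algebra k ℝ] {s : Set (Fin m → ℝ)}
    (hs : IsSemialgebraic k s) (i : Fin m) : IsSemialgebraicFunOn k s (fun x => x i) := by
  simpa using isSemialgebraicFunOn_aeval hs (X i : MvPolynomial (Fin m) k)

/-- Rational constants are `ℚ`-semialgebraic functions on every `ℚ`-semialgebraic set (they are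
polynomials). [cite: BochnakCosteRoy1998, §2.2] -/
theorem isSemialgebraicFunOn_ratCast {s : Set (Fin m → ℝ)} (hs : IsSemialgebraic ℚ s) (q : ℚ) :
    IsSemialgebraicFunOn ℚ s (fun _ => (q : ℝ)) := by
  simpa using isSemialgebraicFunOn_aeval hs (C q : MvPolynomial (Fin m) ℚ)

/-! ### Interval integrals of semialgebraic functions are periods -/

/-- The open unit interval as a subset of `ℝ¹ = (Fin 1 → ℝ)` is `ℚ`-semialgebraic. [folklore] -/
theorem isSemialgebraic_unitInterval_fin_one :
    IsSemialgebraic ℚ {x : Fin 1 → ℝ | 0 < x 0 ∧ x 0 < 1} := by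
  have h1 := Literature.ModelTheory.ExponentialFields.isSemialgebraic_setOf_eval_pos (k := ℚ)
    (R := ℝ) (X 0 : MvPolynomial (Fin 1) ℚ)
  have h2 := Literature.ModelTheory.ExponentialFields.isSemialgebraic_setOf_eval_lt (k := ℚ)
    (R := ℝ) (X 0 : MvPolynomial (Fin 1) ℚ) (1 : MvPolynomial (Fin 1) ℚ)
  simp only [aeval_X, map_one] at h1 h2
  exact h1.inter h2

/-- **Interval integrals of semialgebraic functions are real periods.** If `h : ℝ → ℝ` is
`ℚ`-semialgebraic on `(0, 1)` (as the function `x ↦ h (x 0)` on `ℝ¹`) and integrable on `(0, 1)`,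
then `∫₀¹ h` is a real Kontsevich–Zagier period: `((0, 1), h)` is an integral representation
in the sense of `KZ.IntegralRep 1`, and algebraic integrands give the same periods as rational
ones (`KZ.isRealPeriod_iff_exists_integralRep_holds`; Kontsevich–Zagier 2001, §1.1).
[cite: KontsevichZagier2001, §1.1] -/
theorem isRealPeriod_intervalIntegral {h : ℝ → ℝ}
    (hh : IsSemialgebraicFunOn ℚ {x : Fin 1 → ℝ | 0 < x 0 ∧ x 0 < 1} (fun x => h (x 0)))
    (hint : IntegrableOn h (Ioo 0 1)) : IsRealPeriod (∫ s in (0 : ℝ)..1, h s) := by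
  have hmp := MeasureTheory.volume_preserving_funUnique (Fin 1) ℝ
  have hpre : {x : Fin 1 → ℝ | 0 < x 0 ∧ x 0 < 1} =
      MeasurableEquiv.funUnique (Fin 1) ℝ ⁻¹' Ioo 0 1 := by
    ext x
    simp [MeasurableEquiv.funUnique, Fin.default_eq_zero]
  have hint' : IntegrableOn (fun x : Fin 1 → ℝ => h (x 0)) {x : Fin 1 → ℝ | 0 < x 0 ∧ x 0 < 1} := by
    rw [hpre]
    exact (hmp.integrableOn_comp_preimage (MeasurableEquiv.measurableEmbedding _)).mpr hint
  let r : KZ.IntegralRep 1 :=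
    { domain := {x : Fin 1 → ℝ | 0 < x 0 ∧ x 0 < 1}
      integrand := fun x => h (x 0)
      isSemialgebraic_domain := isSemialgebraic_unitInterval_fin_one
      isSemialgebraicFunOn_integrand := hh
      integrableOn := hint' }
  refine KZ.isRealPeriod_iff_exists_integralRep_holds.mpr ⟨1, r, ?_⟩
  change ∫ x in {x : Fin 1 → ℝ | 0 < x 0 ∧ x 0 < 1}, h (x 0) = ∫ s in (0 : ℝ)..1, h s
  have h1 := hmp.setIntegral_preimage_emb (MeasurableEquiv.measurableEmbedding _) h (Ioo 0 1)
  rw [hpre, intervalIntegral.integral_of_le zero_le_one, integral_Ioc_eq_integral_Ioo, ← h1]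
  rfl

/-- **Interval integrals with semialgebraic real and imaginary parts are periods.** If
`h : ℝ → ℂ` is integrable on `(0, 1)` and `s ↦ re h(s)`, `s ↦ im h(s)` are `ℚ`-semialgebraic on
`(0, 1)`, then `∫₀¹ h` is a Kontsevich–Zagier period (both parts are real periods by
`isRealPeriod_intervalIntegral`). [cite: KontsevichZagier2001, §1.1] -/
theorem isPeriod_intervalIntegral {h : ℝ → ℂ}
    (hre : IsSemialgebraicFunOn ℚ {x : Fin 1 → ℝ | 0 < x 0 ∧ x 0 < 1} (fun x => (h (x 0)).re))
    (him : IsSemialgebraicFunOn ℚ {x : Fin 1 → ℝ | 0 < x 0 ∧ x 0 < 1} (fun x => (h (x 0)).im))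
    (hint : IntegrableOn h (Ioo 0 1)) : IsPeriod (∫ s in (0 : ℝ)..1, h s) := by
  have hre' := isRealPeriod_intervalIntegral hre hint.re
  have him' := isRealPeriod_intervalIntegral him hint.im
  have hint'' : IntervalIntegrable h volume 0 1 := by
    rw [intervalIntegrable_iff_integrableOn_Ioo_of_le zero_le_one]
    exact hint
  constructor
  · have : (∫ s in (0 : ℝ)..1, h s).re = ∫ s in (0 : ℝ)..1, (h s).re := by
      simpa using (Complex.reCLM.intervalIntegral_comp_comm hint'').symm
    rw [this]
    exact hre'
  · have : (∫ s in (0 : ℝ)..1, h s).im = ∫ s in (0 : ℝ)..1, (h s).im := by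
      simpa using (Complex.imCLM.intervalIntegral_comp_comm hint'').symm
    rw [this]
    exact him'

/-! ### Algebraic numbers: closure under roots of monic cubics and under square roots -/

/-- A root of the depressed cubic `4x³ - g₂x - g₃` with `g₂, g₃` algebraic over `ℚ` is algebraic
over `ℚ`: it is integral over the relative algebraic closure `ℚ̄ ∩ ℂ` of `ℚ` in `ℂ` (root of the
monic `X³ - (g₂/4)X - g₃/4`), which is integrally closed in `ℂ` (`isIntegral_trans`). [folklore] -/
theorem isAlgebraic_of_cubic_eq_zero {g₂ g₃ p : ℂ} (h₂ : IsAlgebraic ℚ g₂) (h₃ : IsAlgebraic ℚ g₃)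
    (hp : 4 * p ^ 3 - g₂ * p - g₃ = 0) : IsAlgebraic ℚ p := by
  have h4' : (4 : ℂ) ∈ algebraicClosure ℚ ℂ := ofNat_mem (algebraicClosure ℚ ℂ) 4
  have ha : -g₂ / 4 ∈ algebraicClosure ℚ ℂ :=
    div_mem (neg_mem (mem_algebraicClosure_iff.mpr h₂)) h4'
  have hb : -g₃ / 4 ∈ algebraicClosure ℚ ℂ :=
    div_mem (neg_mem (mem_algebraicClosure_iff.mpr h₃)) h4'
  have hint : IsIntegral (algebraicClosure ℚ ℂ) p := by
    refine ⟨Polynomial.X ^ 3 + (Polynomial.C (⟨-g₂ / 4, ha⟩ : algebraicClosure ℚ ℂ) *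
      Polynomial.X + Polynomial.C (⟨-g₃ / 4, hb⟩ : algebraicClosure ℚ ℂ)), ?_, ?_⟩
    · exact Polynomial.monic_X_pow_add ((Polynomial.degree_linear_le).trans_lt (by norm_num))
    · simp only [Polynomial.eval₂_add, Polynomial.eval₂_X_pow, Polynomial.eval₂_mul,
        Polynomial.eval₂_C, Polynomial.eval₂_X]
      change p ^ 3 + ((-g₂ / 4 : ℂ) * p + (-g₃ / 4 : ℂ)) = 0
      linear_combination hp / 4
  haveI : Algebra.IsIntegral ℚ (algebraicClosure ℚ ℂ) :=
    IsIntegralClosure.isIntegral_algebra ℚ (A := algebraicClosure ℚ ℂ) ℂ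
  exact (isIntegral_trans (R := ℚ) p hint).isAlgebraic

/-- A complex square root of an algebraic number is algebraic. [folklore] -/
theorem isAlgebraic_of_sq_eq {z w : ℂ} (hz : IsAlgebraic ℚ z) (hw : w ^ 2 = z) :
    IsAlgebraic ℚ w :=
  IsAlgebraic.of_pow two_pos (by rw [hw]; exact hz)

end Literature.NumberTheory.Transcendental
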